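import Summits.BirchSwinnertonDyer.BirchSwinnertonDyer.Theorems.Rank2Observatory2DescClSplitImageClassTwo
import HarnessLib

/-!
# BirchSwinnertonDyer — rank ≥ 2 observatory: KERNEL-2DESC-CL — SOUNDNESS OF THE SPLIT LOCAL IMAGE TREE AT 2 (M3c part 2)

HONEST FRAMING: per-curve certified theorems and census instruments; no claim on BSD in rank ≥ 2.

Main theorem `vecTwo_mem_splitImgTwo`: for a square-class map `S : SqClassMapTwo` (part 1, `…SplitImageClassTwo`),
roots `e₀, e₁, e₂ ∈ ℤ_2` congruent to pairwise distinct integers `ē_i` modulo `2^J`, `J = D + 4` (`D = nodeDepth 2 ē`),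
and ANY `x, y ∈ ℚ_2`, `y ≠ 0`, with `y² = (x − e₀)(x − e₁)(x − e₂)`, the 9-bit class vector `vecTwo S x e` is a member
of the computable list `splitImgTwo ē` of M3a (`…SplitImageTree`).

Proof: as at odd `ℓ` (`…SplitImageSound`) with three differences.  (i) A root is DETERMINED at `r = x mod 2^j` only
when `v_2(r − ē_i) + 3 ≤ j` (unit part known modulo 8); (ii) at the TERMINAL level `j = J` the undetermined root's
coset `d + 2^J ℤ_2` (`d = r − ē_i`, `v = v_2(d)`) fixes nothing (`d = 0` or `v ≥ J`), the parity (`v = J − 1`), or the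
parity and `χ₋₁` (`v = J − 2`) — the three cases of `candTwo`, matched by the graded axioms `cls_val` / `cls_chi4`;
(iii) POLES `x = X/2^m`, `X` a unit, `m ≥ 1`: the parity bits of the three `X − 2^m e_i` vanish, so the square
condition forces the parity of `cls (2^{−m})` to vanish, excluding `m = 1` (`cls 2⁻¹` has odd valuation); `m = 2`
gives the four pole leaves `polesTwo` (unit `X − 4e_i ≡ a + 4ē_i (mod 8)`, `a = X mod 8`), and `m ≥ 3` three equal
classes, hence the zero vector.  Completeness of the tree is not claimed and not needed by the rows.

Sorry-free; axioms `propext`, `Classical.choice`, `Quot.sound`.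
[cite: Cassels1991LecturesEllipticCurves, §15]
-/

set_option linter.dupNamespace false
set_option autoImplicit false

namespace Summit.BirchSwinnertonDyer.BirchSwinnertonDyer.Rank2Observatory.TwoDescCl.SplitImage

/-- The numeral `2` of `ℤ_2` coerces to the numeral `2` of `ℚ_2`. [folklore] -/
theorem coe_two : ((2 : ℤ_[2]) : ℚ_[2]) = 2 := rfl

/-! ## §1 Soundness of a node at 2 -/

/-- **Node soundness at 2**: whatever `nodeTwo` accepts at the residue `x mod 2^j` contains the point's vector.
[cite: Cassels1991LecturesEllipticCurves, §15] -/
theorem nodeTwo_sound (S : SqClassMapTwo) {e : Fin 3 → ℤ_[2]} {ē : Fin 3 → ℤ} {J : ℕ}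
    (hJ : J = nodeDepth 2 ē + 4) (hdist : ∀ i k : Fin 3, i ≠ k → ē i ≠ ē k)
    (happ : ∀ i, ∃ t : ℤ_[2], e i = (ē i : ℤ_[2]) + (2 : ℤ_[2]) ^ J * t)
    (X : ℤ_[2]) {y : ℚ_[2]} (hy : y ≠ 0)
    (hcurve : y ^ 2 = ((X : ℚ_[2]) - e 0) * ((X : ℚ_[2]) - e 1) * ((X : ℚ_[2]) - e 2))
    {j : ℕ} (hj : j ≤ J) {vs : List ℕ} (hnode : nodeTwo J ē j ((X.appr j : ℕ) : ℤ) = some vs) :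
    vecTwo S X e ∈ vs := by
  have hok : sqOkTwo (vecTwo S X e) = true := sqOkTwo_vecTwo S hy hcurve
  obtain ⟨t, ht⟩ := exists_appr_add X j
  -- every `x − e_i` is `(r − ē_i) + 2^j T_i`
  have hz : ∀ i, ∃ T : ℤ_[2], (X : ℚ_[2]) - e i =
      ((((X.appr j : ℕ) : ℤ) - ē i : ℤ) : ℚ_[2]) + (2 : ℚ_[2]) ^ j * (T : ℚ_[2]) := by
    intro i
    obtain ⟨tᵢ, htᵢ⟩ := happ i
    obtain ⟨d, hd⟩ := Nat.exists_eq_add_of_le hj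
    refine ⟨t - (2 : ℤ_[2]) ^ d * tᵢ, ?_⟩
    have hXe : X - e i = ((((X.appr j : ℕ) : ℤ) - ē i : ℤ) : ℤ_[2]) +
        (2 : ℤ_[2]) ^ j * (t - (2 : ℤ_[2]) ^ d * tᵢ) := by
      calc X - e i = (((X.appr j : ℕ) : ℤ_[2]) + ((2 : ℕ) : ℤ_[2]) ^ j * t) -
            ((ē i : ℤ_[2]) + (2 : ℤ_[2]) ^ J * tᵢ) := by rw [← ht, ← htᵢ]
        _ = _ := by rw [hd]; push_cast; ring
    have := congrArg (fun z : ℤ_[2] => (z : ℚ_[2])) hXe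
    simpa only [PadicInt.coe_sub, PadicInt.coe_add, PadicInt.coe_mul, PadicInt.coe_pow,
      PadicInt.coe_natCast, PadicInt.coe_intCast, Nat.cast_ofNat, coe_two] using this
  -- a determined root contributes exactly `bitsTwo`
  have hleaf : ∀ i : Fin 3, leafTwo ē j ((X.appr j : ℕ) : ℤ) i = true →
      bitsTwo i.val (((X.appr j : ℕ) : ℤ) - ē i) =
        mkTwo i.val (S.cls ((X : ℚ_[2]) - e i)).1 (S.cls ((X : ℚ_[2]) - e i)).2 := by
    intro i hi
    rw [leafTwo_eq_true_iff] at hi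
    obtain ⟨T, hT⟩ := hz i
    rw [bitsTwo, cls_eq_of_approx_two S T hi.1 hi.2 hT]
  unfold nodeTwo at hnode
  by_cases hall : (leafTwo ē j ((X.appr j : ℕ) : ℤ) 0 && leafTwo ē j ((X.appr j : ℕ) : ℤ) 1 &&
      leafTwo ē j ((X.appr j : ℕ) : ℤ) 2) = true
  · -- a leaf
    rw [if_pos hall] at hnode
    simp only [Bool.and_eq_true] at hall
    have hbv := bvTwo_eq_vec3Two ē ((X.appr j : ℕ) : ℤ) (fun i => S.cls ((X : ℚ_[2]) - e i))
      (fun k => hleaf k (by fin_cases k <;> simp [hall]))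
    have hv : bvTwo ē ((X.appr j : ℕ) : ℤ) = vecTwo S X e := hbv
    rw [hv, hok] at hnode
    simp only [↓reduceIte, Option.some.injEq] at hnode
    rw [← hnode]; exact List.mem_singleton_self _
  · rw [if_neg hall] at hnode
    by_cases hjJ : j < J
    · rw [if_pos hjJ] at hnode; exact absurd hnode (by simp)
    · -- the terminal level
      rw [if_neg hjJ] at hnode
      have hjJ' : j = J := le_antisymm hj (not_lt.mp hjJ)
      subst hjJ'
      set r : ℤ := ((X.appr j : ℕ) : ℤ) with hr
      have hi₀ : leafTwo ē j r (matchTwo ē j r) = false := leafTwo_matchTwo hall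
      have hothers : ∀ k, k ≠ matchTwo ē j r → leafTwo ē j r k = true := fun k hk =>
        leafTwo_of_leafTwo_false hJ (Ne.symm hk) (hdist _ _ (Ne.symm hk)) hi₀
      have hb := baseTwo_add_mkTwo ē r (matchTwo ē j r) (fun i => S.cls ((X : ℚ_[2]) - e i))
        (fun k hk => hleaf k (hothers k hk))
      have hb' : baseTwo ē r (matchTwo ē j r) +
          mkTwo (matchTwo ē j r).val (S.cls ((X : ℚ_[2]) - e (matchTwo ē j r))).1
            (S.cls ((X : ℚ_[2]) - e (matchTwo ē j r))).2 = vecTwo S X e := hb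
      simp only [Option.some.injEq] at hnode
      rw [← hnode, termTwo, List.mem_filterMap]
      refine ⟨S.cls ((X : ℚ_[2]) - e (matchTwo ē j r)), ?_, by simp only [hb', hok, ↓reduceIte]⟩
      -- the class of the undetermined root is a candidate
      obtain ⟨T, hT⟩ := hz (matchTwo ē j r)
      have hsplit : S.cls ((X : ℚ_[2]) - e (matchTwo ē j r)) =
          ((S.cls ((X : ℚ_[2]) - e (matchTwo ē j r))).1,
            ((S.cls ((X : ℚ_[2]) - e (matchTwo ē j r))).2.1,
              (S.cls ((X : ℚ_[2]) - e (matchTwo ē j r))).2.2)) := rfl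
      unfold candTwo
      dsimp only
      by_cases h1 : r - ē (matchTwo ē j r) = 0 ∨ j ≤ valInt 2 (r - ē (matchTwo ē j r))
      · rw [if_pos h1]; exact mem_candTwo_all _
      · rw [if_neg h1]
        simp only [not_or, not_le] at h1
        have hc1 := cls_val_of_approx S T h1.1 h1.2 hT
        by_cases h2 : valInt 2 (r - ē (matchTwo ē j r)) + 1 = j
        · rw [if_pos h2, hsplit, hc1]
          exact mem_candTwo_parity _ _
        · rw [if_neg h2]
          have hc2 := cls_chi4_of_approx S T h1.1 (by omega) hT
          rw [hsplit, hc1, hc2]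
          exact mem_candTwo_pair _ _ (unitPart_two_mod_four h1.1)

/-! ## §2 The level recursion at 2, unfolded -/

/-- The children of the live residues at level `j` (two per residue). [folklore] -/
def childrenTwo (j : ℕ) (live : List ℤ) : List ℤ :=
  live.flatMap fun r0 => [r0, r0 + (2 : ℤ) ^ (j - 1)]

/-- One level at `2`: (residue, node verdict). [folklore] -/
def stepTwo (J : ℕ) (e : Fin 3 → ℤ) (j : ℕ) (live : List ℤ) : List (ℤ × Option (List ℕ)) :=
  (childrenTwo j live).map fun r => (r, nodeTwo J e j r)

/-- The vectors accepted at level `j` (at `2`). [folklore] -/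
def accTwo (J : ℕ) (e : Fin 3 → ℤ) (j : ℕ) (live : List ℤ) : List ℕ :=
  (stepTwo J e j live).flatMap fun p => p.2.getD []

/-- The residues refined further (at `2`). [folklore] -/
def nextTwo (J : ℕ) (e : Fin 3 → ℤ) (j : ℕ) (live : List ℤ) : List ℤ :=
  (stepTwo J e j live).filterMap fun p => if p.2.isNone then some p.1 else none

/-- One unfolding step of the level recursion `levelsTwo` in terms of `accTwo` / `nextTwo`. [folklore] -/
theorem levelsTwo_succ (J : ℕ) (e : Fin 3 → ℤ) (fuel j : ℕ) (live : List ℤ) :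
    levelsTwo J e (fuel + 1) j live =
      accTwo J e j live ++
        (if (nextTwo J e j live).isEmpty then [] else levelsTwo J e fuel (j + 1) (nextTwo J e j live)) :=
  rfl

/-- A mask emitted by a decided child node at level `j` belongs to `accTwo`. [folklore] -/
theorem mem_accTwo {J : ℕ} {e : Fin 3 → ℤ} {j : ℕ} {live : List ℤ} {r : ℤ} {vs : List ℕ} {v : ℕ}
    (hr : r ∈ childrenTwo j live) (hnode : nodeTwo J e j r = some vs) (hv : v ∈ vs) :
    v ∈ accTwo J e j live := by
  rw [accTwo, List.mem_flatMap]
  exact ⟨(r, nodeTwo J e j r), List.mem_map.mpr ⟨r, hr, rfl⟩, by simpa [hnode] using hv⟩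

/-- An undecided child residue at level `j` is passed to the next level (`nextTwo`). [folklore] -/
theorem mem_nextTwo {J : ℕ} {e : Fin 3 → ℤ} {j : ℕ} {live : List ℤ} {r : ℤ}
    (hr : r ∈ childrenTwo j live) (hnode : nodeTwo J e j r = none) : r ∈ nextTwo J e j live := by
  rw [nextTwo, List.mem_filterMap]
  exact ⟨(r, nodeTwo J e j r), List.mem_map.mpr ⟨r, hr, rfl⟩, by simp [hnode]⟩

/-- The digit `x mod 2^j` is a child of `x mod 2^{j-1}`. [folklore] -/
theorem appr_mem_childrenTwo (X : ℤ_[2]) {j : ℕ} (hj : 1 ≤ j) {live : List ℤ}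
    (hlive : ((X.appr (j - 1) : ℕ) : ℤ) ∈ live) : ((X.appr j : ℕ) : ℤ) ∈ childrenTwo j live := by
  obtain ⟨a, ha, hsucc⟩ := appr_succ X (j - 1)
  rw [Nat.sub_add_cancel hj] at hsucc
  rw [childrenTwo, List.mem_flatMap]
  refine ⟨((X.appr (j - 1) : ℕ) : ℤ), hlive, ?_⟩
  have ha' : a = 0 ∨ a = 1 := by omega
  rcases ha' with rfl | rfl
  · rw [hsucc, zero_mul, add_zero]; exact List.mem_cons_self
  · apply List.mem_cons_of_mem
    rw [List.mem_singleton, hsucc]; push_cast; ring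

/-- **Level soundness at 2** (induction on the fuel): the walk of digits of `x` reaches an accepting node.
[cite: Cassels1991LecturesEllipticCurves, §15] -/
theorem levelsTwo_sound (S : SqClassMapTwo) {e : Fin 3 → ℤ_[2]} {ē : Fin 3 → ℤ} {J : ℕ}
    (hJ : J = nodeDepth 2 ē + 4) (hdist : ∀ i k : Fin 3, i ≠ k → ē i ≠ ē k)
    (happ : ∀ i, ∃ t : ℤ_[2], e i = (ē i : ℤ_[2]) + (2 : ℤ_[2]) ^ J * t)
    (X : ℤ_[2]) {y : ℚ_[2]} (hy : y ≠ 0)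
    (hcurve : y ^ 2 = ((X : ℚ_[2]) - e 0) * ((X : ℚ_[2]) - e 1) * ((X : ℚ_[2]) - e 2)) :
    ∀ (fuel j : ℕ) (live : List ℤ), 1 ≤ j → j ≤ J → J + 1 ≤ fuel + j →
      ((X.appr (j - 1) : ℕ) : ℤ) ∈ live → vecTwo S X e ∈ levelsTwo J ē fuel j live := by
  intro fuel
  induction fuel with
  | zero => intro j live hj hjJ hfuel _; omega
  | succ fuel ih =>
    intro j live hj hjJ hfuel hlive
    have hchild := appr_mem_childrenTwo X hj hlive
    rw [levelsTwo_succ, List.mem_append]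
    rcases hnode : nodeTwo J ē j ((X.appr j : ℕ) : ℤ) with _ | vs
    · right
      have hjJ' : j < J := nodeTwo_eq_none hnode
      have hnext := mem_nextTwo hchild hnode
      have hne : (nextTwo J ē j live).isEmpty = false :=
        List.isEmpty_eq_false_iff_exists_mem.mpr ⟨_, hnext⟩
      rw [hne, if_neg Bool.false_ne_true]
      exact ih (j + 1) _ (by omega) (by omega) (by omega) (by simpa using hnext)
    · left
      exact mem_accTwo hchild hnode (nodeTwo_sound S hJ hdist happ X hy hcurve hjJ hnode)

/-! ## §3 Poles at 2 -/

/-- `cls 2⁻¹` has odd valuation (from `cls_val` on `2 = 2 + 4·0` and multiplicativity). [folklore] -/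
theorem cls_two_inv_fst (S : SqClassMapTwo) : (S.cls (2⁻¹ : ℚ_[2])).1 = true := by
  have h20 : (2 : ℚ_[2]) ≠ 0 := two_ne_zero
  have hv2 : padicValInt 2 2 = 1 := by simpa using padicValInt_self (p := 2)
  have hc2 : (S.cls (2 : ℚ_[2])).1 = true := by
    have h := S.cls_val 2 2 2 0 two_ne_zero (by rw [hv2]; norm_num) (by push_cast; ring)
    rw [h, hv2]; decide
  have h1 : S.cls (1 : ℚ_[2]) = (false, (false, false)) := by
    simpa using cls_mul_self S (one_ne_zero (α := ℚ_[2]))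
  have hprod := S.cls_mul 2 2⁻¹ h20 (inv_ne_zero h20)
  rw [mul_inv_cancel₀ h20, h1, hc2] at hprod
  rcases hb : (S.cls (2⁻¹ : ℚ_[2])).1 with _ | _
  · rw [hb] at hprod; simp at hprod
  · rfl

/-- **Poles at 2**: if `x ∉ ℤ_2` then `x = X/4` (`X` a unit) and the vector is one of the four pole leaves, or
`v_2(x) ≤ −3` and the vector vanishes; `v_2(x) = −1` carries no point. [cite: Cassels1991LecturesEllipticCurves, §15] -/
theorem vecTwo_pole (S : SqClassMapTwo) {e : Fin 3 → ℤ_[2]} {ē : Fin 3 → ℤ} {J : ℕ} (hJ : 1 ≤ J)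
    (happ : ∀ i, ∃ t : ℤ_[2], e i = (ē i : ℤ_[2]) + (2 : ℤ_[2]) ^ J * t)
    {x y : ℚ_[2]} (hx : ¬ ‖x‖ ≤ 1) (hy : y ≠ 0) (hcurve : y ^ 2 = (x - e 0) * (x - e 1) * (x - e 2)) :
    vecTwo S x e = 0 ∨ vecTwo S x e ∈ polesTwo ē := by
  have hx0 : x ≠ 0 := by rintro rfl; simp at hx
  have h20 : (2 : ℚ_[2]) ≠ 0 := two_ne_zero
  have h2c : ((2 : ℕ) : ℚ_[2]) = (2 : ℚ_[2]) := Nat.cast_ofNat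
  have h2v : (2 : ℚ_[2]).valuation = 1 := by rw [← h2c]; exact Padic.valuation_p
  have h2n : ‖(2 : ℚ_[2])‖ = (2 : ℝ)⁻¹ := by rw [← h2c, Padic.norm_p]; norm_num
  have hv : x.valuation < 0 := by rw [Padic.norm_le_one_iff_val_nonneg] at hx; omega
  obtain ⟨m, hm⟩ : ∃ m : ℕ, (m : ℤ) = -x.valuation := ⟨(-x.valuation).toNat, Int.toNat_of_nonneg (by omega)⟩
  have hm1 : 1 ≤ m := by omega
  -- `X = 2^m x` is a unit of `ℤ_2`; `a = X mod 8` is odd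
  set X : ℚ_[2] := x * (2 : ℚ_[2]) ^ m with hXdef
  have hX0 : X ≠ 0 := mul_ne_zero hx0 (pow_ne_zero _ h20)
  have hXv : X.valuation = 0 := by
    rw [hXdef, Padic.valuation_mul hx0 (pow_ne_zero _ h20), Padic.valuation_pow, h2v]; omega
  have hXn : ‖X‖ = 1 := by rw [Padic.norm_eq_zpow_neg_valuation hX0, hXv]; simp
  set Xz : ℤ_[2] := ⟨X, hXn.le⟩ with hXz
  obtain ⟨t, ht⟩ := exists_appr_add Xz 3
  set a : ℕ := Xz.appr 3 with ha
  have ha_lt : a < 8 := by have h := PadicInt.appr_lt Xz 3; norm_num at h; exact h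
  have hXq' : (Xz : ℚ_[2]) = (a : ℚ_[2]) + (2 : ℚ_[2]) ^ 3 * (t : ℚ_[2]) := by
    have := congrArg (fun z : ℤ_[2] => (z : ℚ_[2])) ht
    simpa only [PadicInt.coe_add, PadicInt.coe_mul, PadicInt.coe_pow, PadicInt.coe_natCast,
      Nat.cast_ofNat, coe_two] using this
  have hXq : X = (a : ℚ_[2]) + (2 : ℚ_[2]) ^ 3 * (t : ℚ_[2]) := hXq'
  have hodd : a % 2 = 1 := by
    by_contra hev
    obtain ⟨a', ha'⟩ : ∃ a', a = 2 * a' := ⟨a / 2, by omega⟩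
    set w : ℤ_[2] := (a' : ℤ_[2]) + (2 : ℤ_[2]) ^ 2 * t with hw
    have hwq : (w : ℚ_[2]) = (a' : ℚ_[2]) + 4 * (t : ℚ_[2]) := by
      rw [hw]; push_cast [coe_two]; ring
    have hX2 : X = 2 * (w : ℚ_[2]) := by rw [hwq, hXq, ha']; push_cast; ring
    have hlt : ‖X‖ < 1 := by
      rw [hX2, norm_mul, h2n]
      calc (2 : ℝ)⁻¹ * ‖(w : ℚ_[2])‖ ≤ (2 : ℝ)⁻¹ * 1 := by gcongr; exact w.2
        _ < 1 := by norm_num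
    rw [hXn] at hlt; exact lt_irrefl _ hlt
  have ha0 : (a : ℤ) ≠ 0 := by omega
  have h2a : ¬ (2 : ℤ) ∣ (a : ℤ) := by rw [Int.two_dvd_ne_zero]; omega
  have hva : valInt 2 (a : ℤ) = 0 := (unitPart_of_odd h2a).1
  have hua : unitPart 2 (a : ℤ) = a := (unitPart_of_odd h2a).2
  -- `x − e_i = (X − 2^m e_i) · 2^{−m}`
  have hfac : ∀ i, x - (e i : ℚ_[2]) =
      (X - (2 : ℚ_[2]) ^ m * (e i : ℚ_[2])) * ((2 : ℚ_[2]) ^ m)⁻¹ := by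
    intro i
    rw [eq_mul_inv_iff_mul_eq₀ (pow_ne_zero _ h20), hXdef]; ring
  obtain ⟨h0, h1, h2⟩ := ne_zero_of_sq hy hcurve
  have hxe : ∀ i, x - (e i : ℚ_[2]) ≠ 0 := by intro i; fin_cases i <;> assumption
  have hXe : ∀ i, X - (2 : ℚ_[2]) ^ m * (e i : ℚ_[2]) ≠ 0 := by
    intro i h; exact hxe i (by rw [hfac i, h, zero_mul])
  have hinv : ((2 : ℚ_[2]) ^ m)⁻¹ ≠ 0 := inv_ne_zero (pow_ne_zero _ h20)
  have hc : ∀ i, S.cls (x - (e i : ℚ_[2])) =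
      (((S.cls (X - (2 : ℚ_[2]) ^ m * (e i : ℚ_[2]))).1 != (S.cls ((2 : ℚ_[2]) ^ m)⁻¹).1),
        (((S.cls (X - (2 : ℚ_[2]) ^ m * (e i : ℚ_[2]))).2.1 != (S.cls ((2 : ℚ_[2]) ^ m)⁻¹).2.1),
          ((S.cls (X - (2 : ℚ_[2]) ^ m * (e i : ℚ_[2]))).2.2 != (S.cls ((2 : ℚ_[2]) ^ m)⁻¹).2.2))) := by
    intro i; rw [hfac i, S.cls_mul _ _ (hXe i) hinv]
  -- the parity bit of every `X − 2^m e_i` vanishes (`≡ a mod 2`, `a` odd)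
  obtain ⟨m', hm'⟩ : ∃ m', m = m' + 1 := ⟨m - 1, by omega⟩
  have hP1 : ∀ i, (S.cls (X - (2 : ℚ_[2]) ^ m * (e i : ℚ_[2]))).1 = false := by
    intro i
    have hz : X - (2 : ℚ_[2]) ^ m * (e i : ℚ_[2]) = ((a : ℤ) : ℚ_[2]) +
        (2 : ℚ_[2]) ^ 1 * (((2 : ℤ_[2]) ^ 2 * t - (2 : ℤ_[2]) ^ m' * e i : ℤ_[2]) : ℚ_[2]) := by
      rw [hXq, hm']; push_cast [coe_two]; ring
    rw [cls_val_of_approx S _ ha0 (by rw [hva]; exact Nat.one_pos) hz, hva]; decide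
  have hsq := xor3_of_sq_two S hy hcurve
  have hd1 : (S.cls ((2 : ℚ_[2]) ^ m)⁻¹).1 = false := by
    have h := hsq.1
    simp only [hc 0, hc 1, hc 2, hP1 0, hP1 1, hP1 2] at h
    revert h
    rcases (S.cls ((2 : ℚ_[2]) ^ m)⁻¹).1 with _ | _ <;> decide
  -- `m = 1` is impossible: `cls 2⁻¹` has odd valuation
  have hm2 : 2 ≤ m := by
    by_contra hlt
    have hm1' : m = 1 := by omega
    rw [hm1', pow_one, cls_two_inv_fst S] at hd1
    exact Bool.noConfusion hd1
  by_cases hm3 : 3 ≤ m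
  · -- `v(x) ≤ −3`: three equal classes
    left
    obtain ⟨m'', hm''⟩ : ∃ m'', m = m'' + 3 := ⟨m - 3, by omega⟩
    have hP : ∀ i, S.cls (X - (2 : ℚ_[2]) ^ m * (e i : ℚ_[2])) =
        (decide (valInt 2 (a : ℤ) % 2 = 1), chiBits (unitPart 2 (a : ℤ))) := by
      intro i
      have hz : X - (2 : ℚ_[2]) ^ m * (e i : ℚ_[2]) = ((a : ℤ) : ℚ_[2]) +
          (2 : ℚ_[2]) ^ 3 * ((t - (2 : ℤ_[2]) ^ m'' * e i : ℤ_[2]) : ℚ_[2]) := by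
        rw [hXq, hm'']; push_cast [coe_two]; ring
      exact cls_eq_of_approx_two S _ ha0 (by rw [hva]) hz
    have hsq' := hsq
    unfold vecTwo
    simp only [hc 0, hc 1, hc 2, hP 0, hP 1, hP 2] at hsq' ⊢
    revert hsq'
    generalize (S.cls ((2 : ℚ_[2]) ^ m)⁻¹) = d
    generalize decide (valInt 2 (a : ℤ) % 2 = 1) = b1
    generalize chiBits (unitPart 2 (a : ℤ)) = b
    obtain ⟨d1, d2, d3⟩ := d
    obtain ⟨b2, b3⟩ := b
    cases d1 <;> cases d2 <;> cases d3 <;> cases b1 <;> cases b2 <;> cases b3 <;> decide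
  · -- `x = X/4`: the four pole leaves
    right
    have hm2' : m = 2 := by omega
    obtain ⟨J', hJ'⟩ : ∃ J', J = J' + 1 := ⟨J - 1, by omega⟩
    have hP : ∀ i, S.cls (X - (2 : ℚ_[2]) ^ m * (e i : ℚ_[2])) =
        (false, chiBits ((a : ℤ) + 4 * (ē i % 2))) := by
      intro i
      obtain ⟨tᵢ, htᵢ⟩ := happ i
      have hei : (e i : ℚ_[2]) = (ē i : ℚ_[2]) + (2 : ℚ_[2]) ^ J * (tᵢ : ℚ_[2]) := by
        have := congrArg (fun z : ℤ_[2] => (z : ℚ_[2])) htᵢ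
        simpa only [PadicInt.coe_add, PadicInt.coe_mul, PadicInt.coe_pow, PadicInt.coe_natCast,
          PadicInt.coe_intCast, Nat.cast_ofNat, coe_two] using this
      have hw0 : ((a : ℤ) - 4 * ē i) ≠ 0 := by omega
      have hwodd : ¬ (2 : ℤ) ∣ ((a : ℤ) - 4 * ē i) := by rw [Int.two_dvd_ne_zero]; omega
      have hz : X - (2 : ℚ_[2]) ^ m * (e i : ℚ_[2]) = (((a : ℤ) - 4 * ē i : ℤ) : ℚ_[2]) +
          (2 : ℚ_[2]) ^ 3 * ((t - (2 : ℤ_[2]) ^ J' * tᵢ : ℤ_[2]) : ℚ_[2]) := by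
        rw [hXq, hm2', hei, hJ']; push_cast [coe_two]; ring
      rw [cls_eq_of_approx_two S _ hw0 (by rw [(unitPart_of_odd hwodd).1]) hz, (unitPart_of_odd hwodd).1,
        (unitPart_of_odd hwodd).2, chiBits_congr (u' := (a : ℤ) + 4 * (ē i % 2)) (by omega)]
      rfl
    have hd : S.cls ((2 : ℚ_[2]) ^ m)⁻¹ = (false, (false, false)) := by
      rw [hm2', pow_two, mul_inv]; exact cls_mul_self S (inv_ne_zero h20)
    have hvec : vecTwo S x e = mkTwo 0 false (chiBits ((a : ℤ) + 4 * (ē 0 % 2))) +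
        mkTwo 1 false (chiBits ((a : ℤ) + 4 * (ē 1 % 2))) + mkTwo 2 false (chiBits ((a : ℤ) + 4 * (ē 2 % 2))) := by
      unfold vecTwo vec3Two
      simp only [hc 0, hc 1, hc 2, hP 0, hP 1, hP 2, hd, Bool.bne_false]
    have hok : sqOkTwo (vecTwo S x e) = true := sqOkTwo_vecTwo S hy hcurve
    have hmem : (a : ℤ) ∈ ([1, 3, 5, 7] : List ℤ) := by
      have : a = 1 ∨ a = 3 ∨ a = 5 ∨ a = 7 := by omega
      rcases this with h | h | h | h <;> simp [h]
    unfold polesTwo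
    rw [List.mem_filterMap]
    refine ⟨(a : ℤ), hmem, ?_⟩
    rw [hvec] at hok ⊢
    simp only [hok, ↓reduceIte]

/-! ## §4 The main theorem at 2 -/

/-- **SOUNDNESS OF THE SPLIT LOCAL IMAGE TREE AT 2**.  For a square-class map `S` at `2`, roots `e_i ∈ ℤ_2` with
`e_i ≡ ē_i (mod 2^{D+4})` for pairwise distinct integers `ē_i` (`D = nodeDepth 2 ē`), and any `x, y ∈ ℚ_2`,
`y ≠ 0`, with `y² = (x − e₀)(x − e₁)(x − e₂)`: the class vector `(cls (x − e_i))_i` lies in `splitImgTwo ē`.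
[cite: Cassels1991LecturesEllipticCurves, §15] -/
theorem vecTwo_mem_splitImgTwo (S : SqClassMapTwo) {e : Fin 3 → ℤ_[2]} {ē : Fin 3 → ℤ}
    (hdist : ∀ i k : Fin 3, i ≠ k → ē i ≠ ē k)
    (happ : ∀ i, ∃ t : ℤ_[2], e i = (ē i : ℤ_[2]) + (2 : ℤ_[2]) ^ (nodeDepth 2 ē + 4) * t)
    {x y : ℚ_[2]} (hy : y ≠ 0) (hcurve : y ^ 2 = (x - e 0) * (x - e 1) * (x - e 2)) :
    vecTwo S x e ∈ splitImgTwo ē := by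
  unfold splitImgTwo
  dsimp only
  rw [List.mem_dedup]
  by_cases hx : ‖x‖ ≤ 1
  · apply List.mem_cons_of_mem
    rw [List.mem_append]
    right
    set X : ℤ_[2] := ⟨x, hx⟩ with hX
    have hxX : x = (X : ℚ_[2]) := rfl
    rw [hxX] at hcurve ⊢
    have h0 : ((X.appr (1 - 1) : ℕ) : ℤ) ∈ [0] := by
      simp [show X.appr 0 = 0 from rfl]
    exact levelsTwo_sound S rfl hdist happ X hy hcurve (nodeDepth 2 ē + 4 + 1) 1 [0] le_rfl
      (by omega) (by omega) h0
  · rcases vecTwo_pole S (by omega) happ hx hy hcurve with h0 | hp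
    · rw [h0]; exact List.mem_cons_self
    · exact List.mem_cons_of_mem _ (List.mem_append.mpr (Or.inl hp))

end Summit.BirchSwinnertonDyer.BirchSwinnertonDyer.Rank2Observatory.TwoDescCl.SplitImage
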